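import Summits.AtomisticToContinuum.HydrodynamicLimit.Theses.ImplosionDichotomy
import Literature.MathematicalPhysics.KineticTheory.HardSphereEulerProofs
import Literature.Analysis.FluidPDE.HardSphereAlexander
import Literature.Analysis.FunctionSpaces.TorusCalculusProofs
import Literature.Analysis.FunctionSpaces.TorusSpaceTime

/-!
# No BULK dense excursion: `DenseExcursion` strengthened to "packing `η` everywhere" is FALSE

Negative knowledge for the crux `ImplosionDichotomy.DenseExcursion` (stmt-AtomisticToContinuum-12586), from the
standing disprover's `Cruxes/DenseExcursion/Disproof.lean` §7. `DenseExcursionEverywhere` is the crux VERBATIM with the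
final `∃ x, η ≤ ρ_t(x) σ³` strengthened to `∀ x, η ≤ ρ_t(x) σ³`, and it is FALSE, unconditionally:
* MASS IS CONSERVED along every classical hard-sphere-Euler solution, for every `σ` and with NO regularity of the
  equation of state (`integral_density_eq`: continuity equation + divergence theorem on `𝕋³` + differentiation
  under `∫` + one-sided mean value theorem);
* ADMISSIBLE MASS IS ONE (`integral_density_zero_eq_one`: test the `t = 0` tie with `χ ≡ 1`, whose empirical
  density is identically `1`; the local Gibbs laws are probability measures for `σ ≤ 1/2`; a flow family to test
  through exists by Alexander's theorem);
* so packing `η` everywhere at some time would give mass `≥ η σ⁻³ > 1` once `σ³ < η`.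
Hence every witness of the crux is a CONCENTRATION: by the same two facts the dense set `{x | η ≤ ρσ³}` has volume
`≤ σ³/η` (Markov), recorded in the Disproof file. refuter-cdisprove-stmt-AtomisticToContinuum-12586-g2-0.
-/

noncomputable section

namespace Summit.AtomisticToContinuum.HydrodynamicLimit.Theorems

open MeasureTheory Filter Set Topology
open scoped ENNReal
open Literature.MathematicalPhysics.KineticTheory Literature.Analysis.FluidPDE
open Literature.Analysis.FunctionSpaces

/-- The crux `DenseExcursion` strengthened to reach packing `η` EVERYWHERE at some time (all else verbatim). -/
def DenseExcursionEverywhere : Prop :=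
  ∃ η : ℝ, 0 < η ∧ ∃ (a₀ θ₀ : Literature.MathematicalPhysics.KineticTheory.T3 → ℝ) (u₀ : Literature.MathematicalPhysics.KineticTheory.T3 → Literature.MathematicalPhysics.KineticTheory.V3), Continuous a₀ ∧ Continuous θ₀ ∧ Continuous u₀ ∧ (∀ x, 0 < a₀ x) ∧ (∀ x, 0 < θ₀ x) ∧ ∀ σ₀ : ℝ, 0 < σ₀ → ∃ σ : ℝ, 0 < σ ∧ σ < σ₀ ∧ ∃ (T : ℝ) (ρ θ : ℝ → Literature.MathematicalPhysics.KineticTheory.T3 → ℝ) (u : ℝ → Literature.MathematicalPhysics.KineticTheory.T3 → Literature.MathematicalPhysics.KineticTheory.V3), Literature.MathematicalPhysics.KineticTheory.IsHardSphereEulerSolution σ T ρ u θ ∧ (∀ Φ : (N : ℕ) → Literature.Analysis.FluidPDE.HardSphereFlow (Literature.Analysis.FluidPDE.Torus.geometry (Fin 3)) (Literature.MathematicalPhysics.KineticTheory.hsDiameter σ N) (N + 1), Literature.MathematicalPhysics.KineticTheory.TendstoHydroFieldsAt (fun N => Literature.MathematicalPhysics.KineticTheory.localGibbsLaw σ a₀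 u₀ θ₀ N (Φ N)) Φ ρ u θ 0) ∧ ∃ t ∈ Set.Ico 0 T, ∀ x, η ≤ ρ t x * σ ^ 3

namespace DenseExcursionEverywhere

/-- **Mass is conserved** along every classical hard-sphere-Euler solution: `∫ ρ(t) = ∫ ρ(0)` on `[0, T)`, for
every `σ`, WITHOUT any hypothesis on the equation of state (only the continuity equation is integrated). [folklore] -/
theorem integral_density_eq {σ T : ℝ} {ρ θ : ℝ → T3 → ℝ} {u : ℝ → T3 → V3}
    (hE : IsHardSphereEulerSolution σ T ρ u θ) {t : ℝ} (ht : t ∈ Ico 0 T) :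
    ∫ x, ρ t x = ∫ x, ρ 0 x := by
  have hderiv : ∀ s ∈ Ico 0 T, HasDerivWithinAt (fun s => ∫ x, ρ s x) 0 (Ico 0 T) s := by
    intro s hs
    have h1 := hE.smooth_density.hasDerivWithinAt_integral (convex_Ico 0 T) hs
    have h2 : ∫ x, Torus.timeDerivWithin (Ico 0 T) ρ s x = 0 := by
      have hpt : (fun x => Torus.timeDerivWithin (Ico 0 T) ρ s x) =
          fun x => -Torus.divergence (fun y => ρ s y • u s y) x := by
        funext x; have := hE.mass s hs x; linarith
      rw [hpt, integral_neg, neg_eq_zero]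
      exact Torus.integral_divergence_eq_zero_holds
        ((hE.smooth_density.smul hE.smooth_velocity).isSmooth_slice hs)
    rwa [h2] at h1
  have hcont : ContinuousOn (fun s => ∫ x, ρ s x) (Icc 0 t) := fun s hs =>
    ((hderiv s ⟨hs.1, hs.2.trans_lt ht.2⟩).continuousWithinAt).mono (Icc_subset_Ico_right ht.2)
  have hright : ∀ s ∈ Ico 0 t, HasDerivWithinAt (fun s => ∫ x, ρ s x) 0 (Ici s) s := by
    intro s hs
    have hsT : s ∈ Ico 0 T := ⟨hs.1, hs.2.trans ht.2⟩
    refine (hderiv s hsT).mono_of_mem_nhdsWithin ?_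
    exact Filter.mem_of_superset (Ico_mem_nhdsGE hsT.2) (Ico_subset_Ico_left hsT.1)
  exact constant_of_has_deriv_right_zero hcont hright t (right_mem_Icc.2 ht.1)

/-- **Admissible mass is one**: the `t = 0` tie tested with `χ ≡ 1` (empirical density identically `1`, laws of
total mass `1` for `σ ≤ 1/2`) forces `∫ ρ(0) = 1`. [folklore] -/
theorem integral_density_zero_eq_one {σ : ℝ} (hσ2 : σ ≤ 1 / 2) {a₀ θ₀ : T3 → ℝ} {u₀ : T3 → V3}
    (ha : Continuous a₀) (hθ : Continuous θ₀) (hu : Continuous u₀) (ha0 : ∀ x, 0 < a₀ x)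
    (hθ0 : ∀ x, 0 < θ₀ x) {ρ θ : ℝ → T3 → ℝ} {u : ℝ → T3 → V3}
    (Φ : (N : ℕ) → HardSphereFlow (Torus.geometry (Fin 3)) (hsDiameter σ N) (N + 1))
    (hA : TendstoHydroFieldsAt (fun N => localGibbsLaw σ a₀ u₀ θ₀ N (Φ N)) Φ ρ u θ 0) :
    ∫ x, ρ 0 x = 1 := by
  by_contra hne
  have hd : 0 < |1 - ∫ x, ρ 0 x| := abs_pos.2 (sub_ne_zero.2 (Ne.symm hne))
  have h := (hA (fun _ => 1) continuous_const (|1 - ∫ x, ρ 0 x| / 2) (by positivity)).1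
  have hev : ∀ N : ℕ, {z : Config (N + 1) (Fin 3) T3 | |1 - ∫ x, ρ 0 x| / 2 <
      |empiricalDensityField ((Φ N).flow 0 z) (fun _ => 1) - ∫ x, (fun _ => (1 : ℝ)) x * ρ 0 x|} = univ := by
    intro N
    ext z
    simp only [mem_setOf_eq, mem_univ, iff_true, empiricalDensityField_one (Nat.succ_ne_zero N), one_mul]
    linarith
  have hP : ∀ N, IsProbabilityMeasure (localGibbsLaw σ a₀ u₀ θ₀ N (Φ N)) :=
    fun N => isProbabilityMeasure_localGibbsLaw ha hθ hu ha0 hθ0 hσ2 N (Φ N)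
  simp only [hev, measure_univ] at h
  exact one_ne_zero (tendsto_nhds_unique (tendsto_const_nhds (x := (1 : ℝ≥0∞)) (f := atTop)) h)

end DenseExcursionEverywhere

open DenseExcursionEverywhere in
/-- NO BULK PACKING: `DenseExcursion` with `∃ x` strengthened to `∀ x` is false — at the offending time the
conserved unit mass would be `≥ η σ⁻³ > 1` (take `σ < min(1, η, 1/2)` in the witness). [folklore] -/
theorem denseExcursion_false_everywhere : ¬ DenseExcursionEverywhere := by
  rintro ⟨η, hη, a₀, θ₀, u₀, ha, hθ, hu, ha0, hθ0, H⟩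
  obtain ⟨σ, hσ, hσlt, T, ρ, θ, u, hE, hA, t, ht, hx⟩ :=
    H (min (1 / 2) (min 1 η)) (lt_min (by norm_num) (lt_min one_pos hη))
  have hσ2 : σ < 1 / 2 := lt_of_lt_of_le hσlt (min_le_left _ _)
  have hσone : σ < 1 := lt_of_lt_of_le hσlt ((min_le_right _ _).trans (min_le_left _ _))
  have hση : σ < η := lt_of_lt_of_le hσlt ((min_le_right _ _).trans (min_le_right _ _))
  obtain ⟨Φ⟩ : Nonempty ((N : ℕ) → HardSphereFlow (Torus.geometry (Fin 3)) (hsDiameter σ N) (N + 1)) :=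
    ⟨fun N => Classical.choice (HardSphereFlow.nonempty_torus_holds (d := Fin 3)
      (hsDiameter_pos hσ N) ((hsDiameter_le hσ.le N).trans_lt (hσ2.trans_eq (by norm_num))) (N + 1))⟩
  have hmass : ∫ x, ρ t x = 1 := by
    rw [integral_density_eq hE ht]
    exact integral_density_zero_eq_one hσ2.le ha hθ hu ha0 hθ0 Φ (hA Φ)
  have hσ3 : 0 < σ ^ 3 := pow_pos hσ 3
  have hσ3lt : σ ^ 3 < η := by
    have : σ ^ 3 ≤ σ := by
      have e : σ ^ 3 = σ * (σ * σ) := by ring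
      rw [e]; exact mul_le_of_le_one_right hσ.le (by nlinarith)
    exact this.trans_lt hση
  have hint : Integrable (ρ t) volume :=
    integrable_of_continuous_T3 (hE.smooth_density.isSmooth_slice ht).continuous
  have hge : ∫ x : T3, η / σ ^ 3 ≤ ∫ x, ρ t x :=
    integral_mono (integrable_const _) hint fun x => (div_le_iff₀ hσ3).2 (hx x)
  rw [hmass, integral_const, smul_eq_mul] at hge
  simp only [probReal_univ, one_mul] at hge
  rw [div_le_iff₀ hσ3, one_mul] at hge
  exact absurd hge (not_le.2 hσ3lt)

end Summit.AtomisticToContinuum.HydrodynamicLimit.Theorems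

end
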